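import Mathlib
import Summits.Ventures.PercRepro2.Defs
import Summits.Ventures.PercRepro2.Graph
import Summits.Ventures.PercRepro2.Induced
import Summits.Ventures.PercRepro2.VdBKahn
import Summits.Ventures.PercRepro2.ReimerVdBK
import Summits.Ventures.PercRepro2.ReimerVdBKRegions
import Summits.Ventures.PercRepro2.ReimerVdBKZClosed
import Summits.Ventures.PercRepro2.ReimerVdBKZReduction
import Summits.Ventures.PercRepro2.ReimerVdBKZSplit
import Summits.Ventures.PercRepro2.ReimerVdBKZRecursion
import Summits.Ventures.PercRepro2.ReimerVdBKTypeWeight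
import Summits.Ventures.PercRepro2.ReimerVdBKPairType
import Summits.Ventures.PercRepro2.ReimerVdBKCoreDown
import Summits.Ventures.PercRepro2.ReimerVdBKCoreD
import Summits.Ventures.PercRepro2.ReimerVdBKDegTwoGraph
import Summits.Ventures.PercRepro2.ReimerVdBKDegTwoFlip
import Summits.Ventures.PercRepro2.ReimerVdBKDegTwoExpansion
import Summits.Ventures.PercRepro2.ReimerVdBKDegTwoCalc
import Summits.Ventures.PercRepro2.ReimerVdBKLeafGadget
import Summits.Ventures.PercRepro2.ReimerVdBKTwisted
import Summits.Ventures.PercRepro2.ReimerVdBKTied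
import Summits.Ventures.PercRepro2.ReimerVdBKDegThreeGraph
import Summits.Ventures.PercRepro2.ReimerVdBKDegThreeExpansion

/-!
# The degree-3 expansion, III: the class functions with further core-avoided vertices
(blind cell PercRepro2, mine-c g48; `conjectures/MINE-C.md` §56.7 (b), §57)

The pieces of the expansion of `ReimerVdBKDegThreeExpansion` with a set `N` of further core-avoided
vertices (the `F₀`-vertices of the type-weight calculus, `MINE-C.md` §55.3), verbatim the degree-2 rule
of `ReimerVdBKDegTwoCalc`: the `N`-restricted class function of a pattern class (`classFun3N`), the
`N`-restricted GENSYM3 count and statement (`coreGensym3Count`, `GenSym3N`), the core-restricted count on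
a TIED sub-cube and the block-coordinate statement (CORE↓) there (`coreTiedCount`, `CoreDownTied`; with
`N = ∅` it is Harris on the tied sub-cube, `coreDownTied_of_empty`; with `F = ∅` it is (CORE↓) at `N`,
`coreDownTied_empty_F_iff`), and the pointwise split of the core term at an unmarked degree-3 vertex by
the colour pattern of its star (`term_split3N`).  Part IV (`ReimerVdBKDegThreeRule`) sums the split:
the expansion identity and the DEGREE-3 RULE of the calculus.
-/

namespace Summit.Ventures.PercRepro2
namespace ReimerVdBK
open Classical

variable {V : Type*} {E : Type*} [Fintype E] [DecidableEq E] [Fintype V] [DecidableEq V]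
variable (ends : E → Sym2 V) (s : V)

section Defs
variable (A X B Y N : Finset V)

/-- The class function of the pattern class «`e` | the third edge» of a graph `ends'` with the
core-avoidance of `N`: the two-world event restricted to the colourings whose core avoids `N`, weighted by
`[e red]·(1 − [a ∈ K₁][c ∈ K₂]) + [e blue]·(1 − [c ∈ K₁][a ∈ K₂])`. -/
noncomputable def classFun3N (ends' : E → Sym2 V) (e : E) (a c : V) (ω : Config E) : ℕ :=
  if ω ∈ twoWorld ends' s A X B Y ∧ CoreAvoid ends' s N ω then
    (if ω e = true then (if Conn ends' ω s a ∧ Conn ends' (compl ω) s c then 0 else 1)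
      else (if Conn ends' ω s c ∧ Conn ends' (compl ω) s a then 0 else 1)) else 0

/-- The GENSYM3 count restricted to the colourings whose core avoids `N`. -/
noncomputable def coreGensym3Count (e : E) (a c : V) : ℕ :=
  ∑ ω : Config E, classFun3N s A X B Y N ends e a c ω

/-- **GENSYM3`(e; a, c)` restricted to the core-avoidance of `N`** (left ≤ right). -/
def GenSym3N (e : E) (a c : V) : Prop :=
  coreGensym3Count ends s A X B Y N e a c ≤ coreGensym3Count ends s (A ∪ B) ∅ ∅ (X ∪ Y) N e a c

/-- The tied term: the indicator of «in the two-world event, constant on `F`, core avoiding `N`». -/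
noncomputable def tiedFunN (F : Finset E) (ω : Config E) : ℕ :=
  if ω ∈ twoWorld ends s A X B Y ∧ ω ∈ tied F ∧ CoreAvoid ends s N ω then 1 else 0

/-- The core-restricted count on the tied sub-cube of `F`: the colourings of the two-world event that are
constant on `F` and whose core avoids `N`. -/
noncomputable def coreTiedCount (F : Finset E) : ℕ := ∑ ω : Config E, tiedFunN ends s A X B Y N F ω

/-- **(CORE↓) at `N` on the tied sub-cube of `F`** (left ≤ right): the first block-coordinate statement of
the line — with `F` the star of an unmarked vertex it is the tied class of (VCLASS) at `N`. -/
def CoreDownTied (F : Finset E) : Prop :=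
  coreTiedCount ends s A X B Y N F ≤ coreTiedCount ends s (A ∪ B) ∅ ∅ (X ∪ Y) N F

/-- The core term at `v` with `N`: the indicator of «in the two-world event, core avoiding `N`, `v` not in
the core». -/
noncomputable def coreTermN (v : V) (ω : Config E) : ℕ :=
  if ω ∈ twoWorld ends s A X B Y ∧ CoreAvoid ends s N ω ∧ ¬ (Conn ends ω s v ∧ Conn ends (compl ω) s v)
    then 1 else 0

/-- The core-restricted count at `insert v N` is the sum of the core terms. -/
lemma coreCount_insert_eq_sum_coreTermN (v : V) :
    coreCount ends s A X B Y (insert v N) = ∑ ω : Config E, coreTermN ends s A X B Y N v ω := by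
  rw [coreCount_insert_eq_sum]
  rfl

omit [Fintype V] [DecidableEq V] in
/-- With `N = ∅` the tied count is the count of the tied two-world event. -/
lemma coreTiedCount_empty (F : Finset E) :
    coreTiedCount ends s A X B Y ∅ F = count (twoWorld ends s A X B Y ∩ tied F) := by
  unfold coreTiedCount tiedFunN count
  refine Finset.sum_congr rfl fun ω _ => ?_
  have hca : CoreAvoid ends s (∅ : Finset V) ω := fun w hw => absurd hw (Finset.notMem_empty w)
  simp only [Set.mem_inter_iff, hca, and_true]

omit [Fintype V] in
/-- With `N = ∅` the tied (CORE↓) is Harris on the tied sub-cube (`count_tied_le`). -/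
theorem coreDownTied_of_empty (F : Finset E) (hXY : X ∩ Y = ∅) : CoreDownTied ends s A X B Y ∅ F := by
  unfold CoreDownTied
  rw [coreTiedCount_empty, coreTiedCount_empty]
  exact count_tied_le ends s F A X B Y hXY

/-- With `F = ∅` the tied count is the core-restricted count at `N`. -/
lemma coreTiedCount_empty_F : coreTiedCount ends s A X B Y N ∅ = coreCount ends s A X B Y N := by
  rw [coreCount_eq_sum_coreAvoid]
  unfold coreTiedCount tiedFunN
  refine Finset.sum_congr rfl fun ω _ => ?_
  have ht : ω ∈ tied (∅ : Finset E) := fun e he => absurd he (Finset.notMem_empty e)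
  simp only [ht, true_and]

/-- With `F = ∅` the tied (CORE↓) at `N` is (CORE↓) at `N`. -/
lemma coreDownTied_empty_F_iff : CoreDownTied ends s A X B Y N ∅ ↔ CoreDown ends s A X B Y N := by
  unfold CoreDownTied CoreDown
  rw [coreTiedCount_empty_F, coreTiedCount_empty_F]

end Defs

section Expansion
variable {v u₁ u₂ u₃ : V} {e₁ e₂ e₃ : E} (A X B Y N : Finset V)

/-- Monochromatic star, with `N`: the core term is the tied term. -/
lemma term_mono3N (hd : Deg3 ends v u₁ u₂ u₃ e₁ e₂ e₃) (hsv : s ≠ v) {ω : Config E}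
    (h12 : ω e₁ = ω e₂) (h23 : ω e₂ = ω e₃) :
    coreTermN ends s A X B Y N v ω = tiedFunN ends s A X B Y N {e₁, e₂, e₃} ω := by
  have hcore : ¬ (Conn ends ω s v ∧ Conn ends (compl ω) s v) := by
    rintro ⟨hv1, hv2⟩
    cases h : ω e₁ with
    | false => exact not_conn_of_star3_closed ends s hd hsv h (h12 ▸ h) ((h12.trans h23) ▸ h) hv1
    | true =>
      have c1 : compl ω e₁ = false := by simp [compl_apply, h]
      have c2 : compl ω e₂ = false := by simp [compl_apply, ← h12, h]
      have c3 : compl ω e₃ = false := by simp [compl_apply, ← h23, ← h12, h]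
      exact not_conn_of_star3_closed ends s hd hsv c1 c2 c3 hv2
  have htied : ω ∈ tied {e₁, e₂, e₃} := (mem_tied_star ends hd ω).2 ⟨h12, h23⟩
  unfold coreTermN tiedFunN
  by_cases h : ω ∈ twoWorld ends s A X B Y ∧ CoreAvoid ends s N ω
  · have hy : ω ∈ twoWorld ends s A X B Y ∧ CoreAvoid ends s N ω ∧
        ¬ (Conn ends ω s v ∧ Conn ends (compl ω) s v) := ⟨h.1, h.2, hcore⟩
    have hy' : ω ∈ twoWorld ends s A X B Y ∧ ω ∈ tied {e₁, e₂, e₃} ∧ CoreAvoid ends s N ω :=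
      ⟨h.1, htied, h.2⟩
    rw [if_pos hy, if_pos hy']
  · have hn : ¬ (ω ∈ twoWorld ends s A X B Y ∧ CoreAvoid ends s N ω ∧
        ¬ (Conn ends ω s v ∧ Conn ends (compl ω) s v)) := fun h' => h ⟨h'.1, h'.2.1⟩
    have hn' : ¬ (ω ∈ twoWorld ends s A X B Y ∧ ω ∈ tied {e₁, e₂, e₃} ∧ CoreAvoid ends s N ω) :=
      fun h' => h ⟨h'.1, h'.2.2⟩
    rw [if_neg hn, if_neg hn']

/-- Pattern `e₁, e₂` red, `e₃` blue, with `N`: the core term is the class function of `G⁺` with the pin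
`[u₁ ∈ K₁][u₃ ∈ K₂]`. -/
lemma term_TTFN (hd : Deg3 ends v u₁ u₂ u₃ e₁ e₂ e₃) (hsv : s ≠ v) (hv : v ∉ A ∪ X ∪ B ∪ Y) (hvN : v ∉ N)
    {ω : Config E} (h1 : ω e₁ = true) (h2 : ω e₂ = true) (h3 : ω e₃ = false) :
    coreTermN ends s A X B Y N v ω =
      classFun3N s A X B Y N (endsP3 ends v u₁ u₂ e₁ e₂ e₃) e₁ u₁ u₃ ω := by
  have hw : ∀ w ∈ A ∪ X ∪ B ∪ Y, w ≠ v := fun w hw hwv => hv (hwv ▸ hw)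
  have hwN : ∀ w ∈ N, w ≠ v := fun w hw hwv => hvN (hwv ▸ hw)
  obtain ⟨hc1, hv1⟩ := conn_iff_endsP3_merge ends s hd hsv h1 h2 h3
  have c1 : compl ω e₁ = false := by simp [compl_apply, h1]
  have c2 : compl ω e₂ = false := by simp [compl_apply, h2]
  have c3 : compl ω e₃ = true := by simp [compl_apply, h3]
  obtain ⟨hc2, hv2⟩ := conn_iff_endsP3_leaf ends s hd hsv c1 c2 c3
  have htw : ω ∈ twoWorld ends s A X B Y ↔ ω ∈ twoWorld (endsP3 ends v u₁ u₂ e₁ e₂ e₃) s A X B Y :=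
    mem_twoWorld_iff_of_conn_iff ends s A X B Y (fun w hw' => hc1 w (hw w hw'))
      (fun w hw' => hc2 w (hw w hw'))
  have hca : CoreAvoid ends s N ω ↔ CoreAvoid (endsP3 ends v u₁ u₂ e₁ e₂ e₃) s N ω :=
    coreAvoid_iff_of_conn_iff ends s N (fun w hw' => hc1 w (hwN w hw')) (fun w hw' => hc2 w (hwN w hw'))
  unfold coreTermN classFun3N
  by_cases h : ω ∈ twoWorld ends s A X B Y ∧ CoreAvoid ends s N ω
  · have h' : ω ∈ twoWorld (endsP3 ends v u₁ u₂ e₁ e₂ e₃) s A X B Y ∧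
        CoreAvoid (endsP3 ends v u₁ u₂ e₁ e₂ e₃) s N ω := ⟨htw.1 h.1, hca.1 h.2⟩
    rw [if_pos h', if_pos h1]
    by_cases hp : (Conn (endsP3 ends v u₁ u₂ e₁ e₂ e₃) ω s u₁ ∧
        Conn (endsP3 ends v u₁ u₂ e₁ e₂ e₃) (compl ω) s u₃)
    · have hn : ¬ (ω ∈ twoWorld ends s A X B Y ∧ CoreAvoid ends s N ω ∧
          ¬ (Conn ends ω s v ∧ Conn ends (compl ω) s v)) :=
        fun h'' => h''.2.2 ⟨hv1.2 hp.1, hv2.2 hp.2⟩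
      rw [if_pos hp, if_neg hn]
    · have hy : ω ∈ twoWorld ends s A X B Y ∧ CoreAvoid ends s N ω ∧
          ¬ (Conn ends ω s v ∧ Conn ends (compl ω) s v) :=
        ⟨h.1, h.2, fun hc => hp ⟨hv1.1 hc.1, hv2.1 hc.2⟩⟩
      rw [if_neg hp, if_pos hy]
  · have hn : ¬ (ω ∈ twoWorld ends s A X B Y ∧ CoreAvoid ends s N ω ∧
        ¬ (Conn ends ω s v ∧ Conn ends (compl ω) s v)) := fun h' => h ⟨h'.1, h'.2.1⟩
    have hn' : ¬ (ω ∈ twoWorld (endsP3 ends v u₁ u₂ e₁ e₂ e₃) s A X B Y ∧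
        CoreAvoid (endsP3 ends v u₁ u₂ e₁ e₂ e₃) s N ω) := fun h' => h ⟨htw.2 h'.1, hca.2 h'.2⟩
    rw [if_neg hn, if_neg hn']

/-- Pattern `e₁, e₂` blue, `e₃` red, with `N`: the core term is the class function of `G⁺` with the pin
`[u₃ ∈ K₁][u₁ ∈ K₂]`. -/
lemma term_FFTN (hd : Deg3 ends v u₁ u₂ u₃ e₁ e₂ e₃) (hsv : s ≠ v) (hv : v ∉ A ∪ X ∪ B ∪ Y) (hvN : v ∉ N)
    {ω : Config E} (h1 : ω e₁ = false) (h2 : ω e₂ = false) (h3 : ω e₃ = true) :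
    coreTermN ends s A X B Y N v ω =
      classFun3N s A X B Y N (endsP3 ends v u₁ u₂ e₁ e₂ e₃) e₁ u₁ u₃ ω := by
  have hw : ∀ w ∈ A ∪ X ∪ B ∪ Y, w ≠ v := fun w hw hwv => hv (hwv ▸ hw)
  have hwN : ∀ w ∈ N, w ≠ v := fun w hw hwv => hvN (hwv ▸ hw)
  obtain ⟨hc1, hv1⟩ := conn_iff_endsP3_leaf ends s hd hsv h1 h2 h3
  have c1 : compl ω e₁ = true := by simp [compl_apply, h1]
  have c2 : compl ω e₂ = true := by simp [compl_apply, h2]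
  have c3 : compl ω e₃ = false := by simp [compl_apply, h3]
  obtain ⟨hc2, hv2⟩ := conn_iff_endsP3_merge ends s hd hsv c1 c2 c3
  have htw : ω ∈ twoWorld ends s A X B Y ↔ ω ∈ twoWorld (endsP3 ends v u₁ u₂ e₁ e₂ e₃) s A X B Y :=
    mem_twoWorld_iff_of_conn_iff ends s A X B Y (fun w hw' => hc1 w (hw w hw'))
      (fun w hw' => hc2 w (hw w hw'))
  have hca : CoreAvoid ends s N ω ↔ CoreAvoid (endsP3 ends v u₁ u₂ e₁ e₂ e₃) s N ω :=
    coreAvoid_iff_of_conn_iff ends s N (fun w hw' => hc1 w (hwN w hw')) (fun w hw' => hc2 w (hwN w hw'))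
  unfold coreTermN classFun3N
  by_cases h : ω ∈ twoWorld ends s A X B Y ∧ CoreAvoid ends s N ω
  · have h' : ω ∈ twoWorld (endsP3 ends v u₁ u₂ e₁ e₂ e₃) s A X B Y ∧
        CoreAvoid (endsP3 ends v u₁ u₂ e₁ e₂ e₃) s N ω := ⟨htw.1 h.1, hca.1 h.2⟩
    have h1' : ¬ (ω e₁ = true) := by rw [h1]; exact Bool.false_ne_true
    rw [if_pos h', if_neg h1']
    by_cases hp : (Conn (endsP3 ends v u₁ u₂ e₁ e₂ e₃) ω s u₃ ∧
        Conn (endsP3 ends v u₁ u₂ e₁ e₂ e₃) (compl ω) s u₁)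
    · have hn : ¬ (ω ∈ twoWorld ends s A X B Y ∧ CoreAvoid ends s N ω ∧
          ¬ (Conn ends ω s v ∧ Conn ends (compl ω) s v)) :=
        fun h'' => h''.2.2 ⟨hv1.2 hp.1, hv2.2 hp.2⟩
      rw [if_pos hp, if_neg hn]
    · have hy : ω ∈ twoWorld ends s A X B Y ∧ CoreAvoid ends s N ω ∧
          ¬ (Conn ends ω s v ∧ Conn ends (compl ω) s v) :=
        ⟨h.1, h.2, fun hc => hp ⟨hv1.1 hc.1, hv2.1 hc.2⟩⟩
      rw [if_neg hp, if_pos hy]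
  · have hn : ¬ (ω ∈ twoWorld ends s A X B Y ∧ CoreAvoid ends s N ω ∧
        ¬ (Conn ends ω s v ∧ Conn ends (compl ω) s v)) := fun h' => h ⟨h'.1, h'.2.1⟩
    have hn' : ¬ (ω ∈ twoWorld (endsP3 ends v u₁ u₂ e₁ e₂ e₃) s A X B Y ∧
        CoreAvoid (endsP3 ends v u₁ u₂ e₁ e₂ e₃) s N ω) := fun h' => h ⟨htw.2 h'.1, hca.2 h'.2⟩
    rw [if_neg hn, if_neg hn']

/-- The class function with `N` is blind to the colour of `e₂` and of `e₃` (loops of `G⁺`). -/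
lemma classFun3N_flip (hd : Deg3 ends v u₁ u₂ u₃ e₁ e₂ e₃) {e : E} (he : e = e₂ ∨ e = e₃) (ω : Config E) :
    classFun3N s A X B Y N (endsP3 ends v u₁ u₂ e₁ e₂ e₃) e₁ u₁ u₃ (flipE e ω) =
      classFun3N s A X B Y N (endsP3 ends v u₁ u₂ e₁ e₂ e₃) e₁ u₁ u₃ ω := by
  have hloop : (endsP3 ends v u₁ u₂ e₁ e₂ e₃ e).IsDiag := by
    rcases he with rfl | rfl
    · rw [endsP3_e₂ ends hd.ne23]; exact Sym2.mk_isDiag_iff.2 rfl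
    · rw [endsP3_e₃]; exact Sym2.mk_isDiag_iff.2 rfl
  have hne : e₁ ≠ e := by
    rcases he with rfl | rfl
    · exact hd.ne12
    · exact hd.ne13
  have h1 : flipE e ω e₁ = ω e₁ := flipE_apply_of_ne hne ω
  unfold classFun3N
  unfold flipE at h1 ⊢
  simp only [mem_twoWorld_update_of_loop s hloop, coreAvoid_update_of_loop s N hloop, compl_update_flip,
    conn_update_of_loop hloop, h1]

/-- The pointwise split by the colour pattern of the star, with `N`. -/
lemma term_split3N (hd : Deg3 ends v u₁ u₂ u₃ e₁ e₂ e₃) (hsv : s ≠ v) (hv : v ∉ A ∪ X ∪ B ∪ Y)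
    (hvN : v ∉ N) (ω : Config E) :
    coreTermN ends s A X B Y N v ω = sel3 (ω e₁) (ω e₂) (ω e₃)
      (tiedFunN ends s A X B Y N {e₁, e₂, e₃} ω)
      (classFun3N s A X B Y N (endsP3 ends v u₁ u₂ e₁ e₂ e₃) e₁ u₁ u₃ ω)
      (classFun3N s A X B Y N (endsP3 ends v u₃ u₁ e₃ e₁ e₂) e₃ u₃ u₂ ω)
      (classFun3N s A X B Y N (endsP3 ends v u₂ u₃ e₂ e₃ e₁) e₂ u₂ u₁ ω) := by
  by_cases h1 : ω e₁ = true <;> by_cases h2 : ω e₂ = true <;> by_cases h3 : ω e₃ = true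
  · have k1 : ω e₁ = true := h1
    have k2 : ω e₂ = true := h2
    have k3 : ω e₃ = true := h3
    rw [show ∀ m g₃ g₂ g₁ : ℕ, sel3 (ω e₁) (ω e₂) (ω e₃) m g₃ g₂ g₁ = m from
      fun m g₃ g₂ g₁ => by rw [k1, k2, k3]; rfl]
    exact term_mono3N ends s A X B Y N hd hsv (k1.trans k2.symm) (k2.trans k3.symm)
  · have k1 : ω e₁ = true := h1
    have k2 : ω e₂ = true := h2
    have k3 : ω e₃ = false := Bool.eq_false_iff.2 h3
    rw [show ∀ m g₃ g₂ g₁ : ℕ, sel3 (ω e₁) (ω e₂) (ω e₃) m g₃ g₂ g₁ = g₃ from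
      fun m g₃ g₂ g₁ => by rw [k1, k2, k3]; rfl]
    exact term_TTFN ends s A X B Y N hd hsv hv hvN k1 k2 k3
  · have k1 : ω e₁ = true := h1
    have k2 : ω e₂ = false := Bool.eq_false_iff.2 h2
    have k3 : ω e₃ = true := h3
    rw [show ∀ m g₃ g₂ g₁ : ℕ, sel3 (ω e₁) (ω e₂) (ω e₃) m g₃ g₂ g₁ = g₂ from
      fun m g₃ g₂ g₁ => by rw [k1, k2, k3]; rfl]
    exact term_TTFN ends s A X B Y N hd.rot.rot hsv hv hvN k3 k1 k2
  · have k1 : ω e₁ = true := h1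
    have k2 : ω e₂ = false := Bool.eq_false_iff.2 h2
    have k3 : ω e₃ = false := Bool.eq_false_iff.2 h3
    rw [show ∀ m g₃ g₂ g₁ : ℕ, sel3 (ω e₁) (ω e₂) (ω e₃) m g₃ g₂ g₁ = g₁ from
      fun m g₃ g₂ g₁ => by rw [k1, k2, k3]; rfl]
    exact term_FFTN ends s A X B Y N hd.rot hsv hv hvN k2 k3 k1
  · have k1 : ω e₁ = false := Bool.eq_false_iff.2 h1
    have k2 : ω e₂ = true := h2
    have k3 : ω e₃ = true := h3
    rw [show ∀ m g₃ g₂ g₁ : ℕ, sel3 (ω e₁) (ω e₂) (ω e₃) m g₃ g₂ g₁ = g₁ from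
      fun m g₃ g₂ g₁ => by rw [k1, k2, k3]; rfl]
    exact term_TTFN ends s A X B Y N hd.rot hsv hv hvN k2 k3 k1
  · have k1 : ω e₁ = false := Bool.eq_false_iff.2 h1
    have k2 : ω e₂ = true := h2
    have k3 : ω e₃ = false := Bool.eq_false_iff.2 h3
    rw [show ∀ m g₃ g₂ g₁ : ℕ, sel3 (ω e₁) (ω e₂) (ω e₃) m g₃ g₂ g₁ = g₂ from
      fun m g₃ g₂ g₁ => by rw [k1, k2, k3]; rfl]
    exact term_FFTN ends s A X B Y N hd.rot.rot hsv hv hvN k3 k1 k2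
  · have k1 : ω e₁ = false := Bool.eq_false_iff.2 h1
    have k2 : ω e₂ = false := Bool.eq_false_iff.2 h2
    have k3 : ω e₃ = true := h3
    rw [show ∀ m g₃ g₂ g₁ : ℕ, sel3 (ω e₁) (ω e₂) (ω e₃) m g₃ g₂ g₁ = g₃ from
      fun m g₃ g₂ g₁ => by rw [k1, k2, k3]; rfl]
    exact term_FFTN ends s A X B Y N hd hsv hv hvN k1 k2 k3
  · have k1 : ω e₁ = false := Bool.eq_false_iff.2 h1
    have k2 : ω e₂ = false := Bool.eq_false_iff.2 h2
    have k3 : ω e₃ = false := Bool.eq_false_iff.2 h3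
    rw [show ∀ m g₃ g₂ g₁ : ℕ, sel3 (ω e₁) (ω e₂) (ω e₃) m g₃ g₂ g₁ = m from
      fun m g₃ g₂ g₁ => by rw [k1, k2, k3]; rfl]
    exact term_mono3N ends s A X B Y N hd hsv (k1.trans k2.symm) (k2.trans k3.symm)

omit [Fintype E] [Fintype V] [DecidableEq V] in
/-- The tied term vanishes off the monochromatic colourings. -/
lemma tiedFunN_eq_zero_of_not_mono (hd : Deg3 ends v u₁ u₂ u₃ e₁ e₂ e₃) {ω : Config E}
    (hm : ¬ (ω e₁ = ω e₂ ∧ ω e₂ = ω e₃)) : tiedFunN ends s A X B Y N {e₁, e₂, e₃} ω = 0 := by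
  unfold tiedFunN
  have hn : ¬ (ω ∈ twoWorld ends s A X B Y ∧ ω ∈ tied {e₁, e₂, e₃} ∧ CoreAvoid ends s N ω) :=
    fun h' => hm ((mem_tied_star ends hd ω).1 h'.2.1)
  rw [if_neg hn]

end Expansion

end ReimerVdBK
end Summit.Ventures.PercRepro2
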